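/-
Copyright: the b2b-balaban cell (near-miss cell 7), T⁴-continuum fan-out; row NE7b ROUND-2 swarm, seat
t4-ne7b-formalise-leaf-10 (row S7 of `t4/b2b-balaban-t4-ne7b-p1/LEAVES-NE7b.md`).  Released under the licence of the
surrounding project.
-/
import Summits.QuantumFields.BalabanUV.T4Continuum.Support.HistoryAdmissible
import Summits.QuantumFields.BalabanUV.T4Continuum.Support.HistoryTables

/-!
# History slots (H2e): the root event, the label caps and the root cell of a physical genealogy; within-term injectivity

Summits-side support leaf of the T⁴-continuum cell (rung (B)+1 on a FINITE torus only; NOT infinite volume, NOT the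
mass gap, NOT the Clay statement; NOT a proof of the spine estimate NE7b).  Row NE7b, route «COUNT», ROUND-2 swarm
claim table `t4/b2b-balaban-t4-ne7b-p1/LEAVES-NE7b.md` row S7 («H2e slots»), seat `t4-ne7b-formalise-leaf-10`; by the
owner's ruling R-OWNER-22-1 the assembly targets the TREE-COUNT socket `Support/HistorySocketTH.LiveHistoriesTH` (this
seat's §0), whose (H2e) fields per live member `(z, G′)` are `cell_mem` (`z ∈ Cell K (K − G′.rootStep)`), `canon`
(`relabel (shape ∘ sh) G′ ∈ canonFam Dcap Ncap K G′.rootStep`, obtained by `T4CanonicalMenus.mem_canonFam_of_chrono` from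
chronology + a CLASS CAP on birth labels + a FUEL CAP) and `slot_inj` WITHIN a class.  [folklore] finite combinatorics
over the lineage's OWN carrier: S1's physical genealogies `HistoryAdmissible.PGen` (p207789) with their canonical label
`PGen.toGen : PGen γ → Gen PEv` — the SHAPE TREE of the member (S3 exports `relabel (shape ∘ sh) (genT …) = PGen.toGen …`)
— and the S12 cell table `HistoryTables.cellN` (p207678).  Nothing is quoted from print, nothing printed is asserted,
no `[cite:]` tag, NO `Prop`-valued fact is minted (trigger c1): the side conditions are PARAMETRISED, DECIDABLE
predicates on the data (`ClassLT`, `CellsIn`, `ScaleCells`), displayed, never assumed.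

WHAT (per physical genealogy `P : PGen γ`; all [K]).
§1 ROOT EVENT.  `rootCls P` (class of the first-born constituent, ties towards the endpoint as `PGen.rootCell`),
**`root_toGen : P.toGen.root = (P.rootStep, 0, rootCls P)`**; `ClassLT D P` (every constituent class `< D`),
`rootCls_lt`.
§2 LABELS (for the `canon` field's caps).  Under `P.Adm K` every label is dated in `[P.rootStep, K]`
(`rootStep_le_step_of_mem`, `step_le_of_mem`); `shape_of_mem` (births carry a constituent class, renewal∕merger labels are
THIN); **`fat_lt_of_classLT`** (= the hypothesis `hfat` of `mem_canonFam_of_chrono` on the shape tree: every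
birth-shaped label has class `< D`); **`fuel_toGen_le`** (`fuel P.toGen ≤` the number of events `P.evTypes.card`, for the
fuel cap `Ncap`).
§3 ROOT CELL (field `cell_mem`).  `CellsIn Cell K P` (every constituent born at `j` is rooted at a cell of age `K − j`);
**`rootCell_mem`**: `CellsIn Cell K P → P.rootCell ∈ Cell K (K − P.rootStep)`; `mapCell` (relabel the cells, e.g. torus
cells ↦ ℕ-vectors) with `toGen_mapCell`∕`rootStep_mapCell`∕`rootCell_mapCell`∕`lastStep_mapCell`∕`adm_mapCell`, and the
torus instance **`rootCell_mem_cellN`** (`ScaleCells L P`: constituents born at `j` sit at scale-`j` torus cells ⇒ the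
ℕ-vector of the root cell lies in `cellN d n L K (K − P.rootStep)`, for `P.Adm K`).
§4 SLOTS (field `slot_inj`, within ONE term).  The branching slot of the member is `⟨P.rootStep, P.rootCell, P.toGen⟩`;
a family of physical genealogies with pairwise distinct (root step, root cell) — the live components of ONE term have
disjoint regions, hence distinct root cells at equal root steps — is mapped injectively to branching slots
(**`bslot_injOn_of_rootInj`**), and likewise to the Z-route slots `⟨rootStep, rootCell, root, record⟩`
(`slot_injOn_of_rootInj`).
§5 Sanity, decided (S1's `hist`).

NOT DONE HERE: the geometric layer H1b (`Support/HistoryRealise`, OPEN) that DISCHARGES `ClassLT (Dcap K)` (regions are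
smaller than the torus), `ScaleCells` (anchor cells are scale cells) and the distinct-root-cells hypothesis (disjoint
regions) on Bałaban's data; the cross-term `str_inj` and `old`, which are the assembly's DEFINITIONS of the classes
(keyed by branching slot families; bad = an old member).  NE7b NOT proved; spine 0∕9.

HONEST DEPENDENCY (cell): continuum YM on T⁴ ⇐ BetaPertH ∧ nine spine estimates (0/9 proved); BetaPertH ⇐ (D1) ∧ (D4)
∧ CAP+tail.  This file changes none of it.
-/

open Finset
open Literature.MathematicalPhysics.QuantumFieldTheory.Balaban1983to89
open T4PersistenceDictionary T4PrintedShapeBanking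
open Summit.QuantumFields.BalabanUV.T4Continuum.HistoryAdmissible
open Summit.QuantumFields.BalabanUV.T4Continuum.HistoryTables
open Summit.QuantumFields.BalabanUV.T4Continuum.ZoneTorus
open T4BranchingRecordsGas T4CanonicalMenus

namespace Summit.QuantumFields.BalabanUV.T4Continuum.HistorySlots

variable {γ : Type*}

/-! ## §1 The root event of the canonical label -/

/-- **THE ROOT CLASS**: the class of the first-born constituent (ties towards the endpoint `X`, exactly as
`PGen.rootCell` and `Gen.root`). [folklore] -/
def rootCls : PGen γ → ℕ
  | .birth _ d _ => d
  | .renew G _ => rootCls G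
  | .join X Y _ => if X.rootStep ≤ Y.rootStep then rootCls X else rootCls Y

/-- **THE ROOT EVENT OF THE CANONICAL LABEL** is the birth label `(rootStep, 0, rootCls)`. [folklore] -/
theorem root_toGen : ∀ P : PGen γ, P.toGen.root = ((P.rootStep, 0, rootCls P) : PEv)
  | .birth j d z => rfl
  | .renew G h => by
      simp only [PGen.toGen, Gen.root, PGen.rootStep, rootCls]
      exact root_toGen G
  | .join X Y s => by
      simp only [PGen.toGen, Gen.root, PGen.rootStep_toGen, PGen.rootStep, rootCls]
      split_ifs with h
      · rw [root_toGen X, min_eq_left h]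
      · rw [root_toGen Y, min_eq_right (not_le.mp h).le]

/-- the root event is a birth label (kind `0`) dated at the root step [folklore] -/
theorem root_kind_step (P : PGen γ) : P.toGen.root.kind = 0 ∧ P.toGen.root.step = P.rootStep := by
  rw [root_toGen]; exact ⟨rfl, rfl⟩

/-- **`ClassLT D P`**: every constituent region of the history has class `< D` (on the finite torus: `D = Dcap K`, the
torus side in `MR`-units; a geometric fact of H1b, displayed here). [folklore] -/
def ClassLT (D : ℕ) : PGen γ → Prop
  | .birth _ d _ => d < D
  | .renew G _ => ClassLT D G
  | .join X Y _ => ClassLT D X ∧ ClassLT D Y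

/-- `ClassLT` is decidable [folklore] -/
instance instDecidableClassLT (D : ℕ) : ∀ P : PGen γ, Decidable (ClassLT D P)
  | .birth _ d _ => inferInstanceAs (Decidable (d < D))
  | .renew G _ => instDecidableClassLT D G
  | .join X Y _ =>
      haveI := instDecidableClassLT D X
      haveI := instDecidableClassLT D Y
      inferInstanceAs (Decidable (ClassLT D X ∧ ClassLT D Y))

/-- the root class is one of the classes [folklore] -/
theorem rootCls_lt {D : ℕ} : ∀ {P : PGen γ}, ClassLT D P → rootCls P < D
  | .birth _ _ _, h => h
  | .renew G _, h => rootCls_lt (P := G) h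
  | .join X Y _, h => by
      simp only [rootCls]
      split_ifs
      · exact rootCls_lt h.1
      · exact rootCls_lt h.2

/-- a class bound is positive (there is a constituent) [folklore] -/
theorem pos_of_classLT {D : ℕ} {P : PGen γ} (h : ClassLT D P) : 0 < D :=
  lt_of_le_of_lt (Nat.zero_le _) (rootCls_lt h)

/-! ## §2 The labels of the canonical label: dates, shapes, class cap, fuel -/

/-- under the timing discipline every event of the label is dated no later than the last step [folklore] -/
theorem step_le_lastStep_of_mem {K : ℕ} :
    ∀ {P : PGen γ}, P.Adm K → ∀ e ∈ P.toGen.events, PEv.step e ≤ P.lastStep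
  | .birth j d z, _, e, he => by
      simp only [PGen.toGen, Gen.events_born, mem_singleton] at he
      subst he; simp [PGen.lastStep, PEv.step]
  | .renew G h, hA, e, he => by
      simp only [PGen.toGen, Gen.events_renew, mem_insert] at he
      simp only [PGen.lastStep]
      rcases he with rfl | he
      · simp [PEv.step]
      · exact (step_le_lastStep_of_mem hA.1 e he).trans (hA.2.1.trans (Nat.le_succ h))
  | .join X Y s, hA, e, he => by
      simp only [PGen.toGen, Gen.events_merge, mem_insert, mem_union] at he
      simp only [PGen.lastStep]
      rcases he with rfl | he | he
      · simp [PEv.step]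
      · exact (step_le_lastStep_of_mem hA.1 e he).trans hA.2.2.1
      · exact (step_le_lastStep_of_mem hA.2.1 e he).trans hA.2.2.2.1

/-- … hence no later than the cutoff [folklore] -/
theorem step_le_of_mem {K : ℕ} {P : PGen γ} (hA : P.Adm K) {e : PEv} (he : e ∈ P.toGen.events) :
    PEv.step e ≤ K :=
  (step_le_lastStep_of_mem hA e he).trans (PGen.Adm.lastStep_le hA)

/-- under the timing discipline every event of the label is dated no earlier than the root step [folklore] -/
theorem rootStep_le_step_of_mem {K : ℕ} :
    ∀ {P : PGen γ}, P.Adm K → ∀ e ∈ P.toGen.events, P.rootStep ≤ PEv.step e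
  | .birth j d z, _, e, he => by
      simp only [PGen.toGen, Gen.events_born, mem_singleton] at he
      subst he; simp [PGen.rootStep, PEv.step]
  | .renew G h, hA, e, he => by
      simp only [PGen.toGen, Gen.events_renew, mem_insert] at he
      simp only [PGen.rootStep]
      rcases he with rfl | he
      · have := PGen.Adm.rootStep_le_lastStep hA.1
        have := hA.2.1
        simp only [PEv.step]; omega
      · exact rootStep_le_step_of_mem hA.1 e he
  | .join X Y s, hA, e, he => by
      simp only [PGen.toGen, Gen.events_merge, mem_insert, mem_union] at he
      simp only [PGen.rootStep]
      rcases he with rfl | he | he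
      · have := PGen.Adm.rootStep_le_lastStep hA.1
        have := hA.2.2.1
        simp only [PEv.step]; omega
      · exact (min_le_left _ _).trans (rootStep_le_step_of_mem hA.1 e he)
      · exact (min_le_right _ _).trans (rootStep_le_step_of_mem hA.2.1 e he)

/-- **THE SHAPE OF THE LABELS**: every event of the canonical label is a birth `(t, 0, d)` with `d` a constituent class
(so `d < D` under `ClassLT D`), or a THIN renewal `(t, 1, 0)` or merger `(t, 2, 0)` label. [folklore] -/
theorem shape_of_mem {D : ℕ} :
    ∀ {P : PGen γ}, ClassLT D P → ∀ e ∈ P.toGen.events,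
      (e.kind = 0 ∧ e.fat < D) ∨ ((e.kind = 1 ∨ e.kind = 2) ∧ e.fat = 0)
  | .birth j d z, hD, e, he => by
      simp only [PGen.toGen, Gen.events_born, mem_singleton] at he
      subst he; exact Or.inl ⟨rfl, hD⟩
  | .renew G h, hD, e, he => by
      simp only [PGen.toGen, Gen.events_renew, mem_insert] at he
      rcases he with rfl | he
      · exact Or.inr ⟨Or.inl rfl, rfl⟩
      · exact shape_of_mem (P := G) hD e he
  | .join X Y s, hD, e, he => by
      simp only [PGen.toGen, Gen.events_merge, mem_insert, mem_union] at he
      rcases he with rfl | he | he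
      · exact Or.inr ⟨Or.inr rfl, rfl⟩
      · exact shape_of_mem hD.1 e he
      · exact shape_of_mem hD.2 e he

/-- **THE CLASS CAP ON THE SHAPE TREE** (the hypothesis `hfat` of `T4CanonicalMenus.mem_canonFam_of_chrono`): under
`ClassLT D P` every birth-shaped label of the canonical label has class `< D`. [folklore] -/
theorem fat_lt_of_classLT {D : ℕ} {P : PGen γ} (hD : ClassLT D P) :
    ∀ e ∈ P.toGen.events, e.kind = 0 → e.fat < D := by
  intro e he hk
  rcases shape_of_mem hD e he with ⟨-, h⟩ | ⟨hk', -⟩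
  · exact h
  · rcases hk' with h1 | h2
    · rw [hk] at h1; exact absurd h1 (by decide)
    · rw [hk] at h2; exact absurd h2 (by decide)

/-- **THE FUEL OF THE SHAPE TREE** is at most the number of events of the history (for the fuel cap `Ncap`). [folklore] -/
theorem fuel_toGen_le : ∀ P : PGen γ, fuel P.toGen ≤ Multiset.card P.evTypes
  | .birth _ _ _ => le_rfl
  | .renew G _ => by
      simp only [PGen.toGen, fuel, PGen.evTypes, Multiset.card_cons]
      exact Nat.succ_le_succ (fuel_toGen_le G)
  | .join X Y _ => by
      simp only [PGen.toGen, fuel, PGen.evTypes, Multiset.card_cons, Multiset.card_add]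
      have hX := fuel_toGen_le X
      have hY := fuel_toGen_le Y
      omega

/-! ## §3 The root cell -/

/-- **`CellsIn Cell K P`**: every constituent born at step `j` is rooted at a cell of age `K − j` of the cell table
(geometric, displayed; on the torus see `rootCell_mem_cellN`). [folklore] -/
def CellsIn (Cell : ℕ → ℕ → Finset γ) (K : ℕ) : PGen γ → Prop
  | .birth j _ z => z ∈ Cell K (K - j)
  | .renew G _ => CellsIn Cell K G
  | .join X Y _ => CellsIn Cell K X ∧ CellsIn Cell K Y

/-- **FIELD `cell_mem`**: the root cell is a cell of the root's age. [folklore] -/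
theorem rootCell_mem {Cell : ℕ → ℕ → Finset γ} {K : ℕ} :
    ∀ {P : PGen γ}, CellsIn Cell K P → P.rootCell ∈ Cell K (K - P.rootStep)
  | .birth _ _ _, h => h
  | .renew G _, h => rootCell_mem (P := G) h
  | .join X Y _, h => by
      simp only [PGen.rootCell, PGen.rootStep]
      split_ifs with hle
      · rw [min_eq_left hle]; exact rootCell_mem h.1
      · rw [min_eq_right (not_le.mp hle).le]; exact rootCell_mem h.2

/-- relabelling the cells of a physical genealogy (e.g. torus cells ↦ ℕ-vectors) [folklore] -/
def mapCell {γ' : Type*} (f : γ → γ') : PGen γ → PGen γ'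
  | .birth j d z => .birth j d (f z)
  | .renew G h => .renew (mapCell f G) h
  | .join X Y s => .join (mapCell f X) (mapCell f Y) s

/-- relabelling keeps the root step [folklore] -/
@[simp] theorem rootStep_mapCell {γ' : Type*} (f : γ → γ') : ∀ P : PGen γ, (mapCell f P).rootStep = P.rootStep
  | .birth _ _ _ => rfl
  | .renew G _ => by simp [mapCell, PGen.rootStep, rootStep_mapCell f G]
  | .join X Y _ => by simp [mapCell, PGen.rootStep, rootStep_mapCell f X, rootStep_mapCell f Y]

/-- relabelling commutes with the root cell [folklore] -/
@[simp] theorem rootCell_mapCell {γ' : Type*} (f : γ → γ') : ∀ P : PGen γ, (mapCell f P).rootCell = f P.rootCell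
  | .birth _ _ _ => rfl
  | .renew G _ => by simp [mapCell, PGen.rootCell, rootCell_mapCell f G]
  | .join X Y _ => by
      simp only [mapCell, PGen.rootCell, rootStep_mapCell, rootCell_mapCell f X, rootCell_mapCell f Y]
      split_ifs <;> rfl

/-- relabelling the cells does not change the canonical label [folklore] -/
@[simp] theorem toGen_mapCell {γ' : Type*} (f : γ → γ') : ∀ P : PGen γ, (mapCell f P).toGen = P.toGen
  | .birth _ _ _ => rfl
  | .renew G _ => by simp [mapCell, PGen.toGen, toGen_mapCell f G]
  | .join X Y _ => by simp [mapCell, PGen.toGen, toGen_mapCell f X, toGen_mapCell f Y]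

/-- relabelling keeps the last step [folklore] -/
@[simp] theorem lastStep_mapCell {γ' : Type*} (f : γ → γ') : ∀ P : PGen γ, (mapCell f P).lastStep = P.lastStep
  | .birth _ _ _ => rfl
  | .renew _ _ => rfl
  | .join _ _ _ => rfl

/-- … nor the timing discipline [folklore] -/
theorem adm_mapCell {γ' : Type*} (f : γ → γ') {K : ℕ} : ∀ {P : PGen γ}, P.Adm K → (mapCell f P).Adm K
  | .birth _ _ _, h => h
  | .renew G _, h => ⟨adm_mapCell f h.1, (lastStep_mapCell f G).symm ▸ h.2.1, h.2.2⟩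
  | .join X Y _, h =>
      ⟨adm_mapCell f h.1, adm_mapCell f h.2.1, (lastStep_mapCell f X).symm ▸ h.2.2.1,
        (lastStep_mapCell f Y).symm ▸ h.2.2.2.1, h.2.2.2.2⟩

section Torus

variable {d : ℕ}

/-- **`ScaleCells L P`** on the torus `TCell d N`: every constituent born at step `j` is rooted at a cell of scale `j`
(`ZoneTorus.IsScale L j`). [folklore] -/
def ScaleCells {N : ℕ} (L : ℕ) : PGen (TCell d N) → Prop
  | .birth j _ z => IsScale L j z
  | .renew G _ => ScaleCells L G
  | .join X Y _ => ScaleCells L X ∧ ScaleCells L Y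

/-- the ℕ-vector of a torus cell [folklore] -/
def valVec {N : ℕ} (x : TCell d N) : Fin d → ℕ := fun i => ((x i : Fin N) : ℕ)

/-- on the torus, scale cells of constituents born by the cutoff are age cells of the table `cellN` [folklore] -/
theorem cellsIn_cellN_of_scaleCells {n L K : ℕ} :
    ∀ {P : PGen (TCell d (n * L ^ K))}, P.Adm K → ScaleCells L P →
      CellsIn (cellN d n L) K (mapCell valVec P)
  | .birth j _ z, hA, hS => by
      simp only [mapCell, CellsIn]
      have hj : j ≤ K := hA
      have e : K - (K - j) = j := Nat.sub_sub_self hj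
      exact valVec_mem_cellN (e.symm ▸ hS)
  | .renew G _, hA, hS => cellsIn_cellN_of_scaleCells (P := G) hA.1 hS
  | .join X Y _, hA, hS =>
      ⟨cellsIn_cellN_of_scaleCells hA.1 hS.1, cellsIn_cellN_of_scaleCells hA.2.1 hS.2⟩

/-- **FIELD `cell_mem` ON THE TORUS** (`Cell := cellN d n L`): the ℕ-vector of the root cell of a physical genealogy
whose constituents sit at scale cells is a cell of the root's age. [folklore] -/
theorem rootCell_mem_cellN {n L K : ℕ} {P : PGen (TCell d (n * L ^ K))} (hA : P.Adm K) (hS : ScaleCells L P) :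
    valVec P.rootCell ∈ cellN d n L K (K - P.rootStep) := by
  have h := rootCell_mem (cellsIn_cellN_of_scaleCells hA hS)
  rwa [rootCell_mapCell, rootStep_mapCell] at h

end Torus

/-! ## §4 Slots: within-term injectivity -/

/-- **WITHIN-TERM BRANCHING-SLOT INJECTIVITY.**  On a family of physical genealogies with pairwise distinct (root step,
root cell) — the live components of ONE term: disjoint regions, hence distinct root cells at equal root steps — the
branching slot `⟨rootStep, rootCell, shape tree⟩` is injective (it is `HistorySocketTH.bslotOf sh (P.rootCell, G′)` for
any tagged `G′` of shape `P.toGen` rooted at `P.rootStep`). [folklore] -/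
theorem bslot_injOn_of_rootInj {S : Set (PGen γ)}
    (h : ∀ P ∈ S, ∀ P' ∈ S, P.rootStep = P'.rootStep → P.rootCell = P'.rootCell → P = P') :
    Set.InjOn (fun P => (⟨P.rootStep, P.rootCell, P.toGen⟩ : BSlot γ PEv)) S := by
  intro P hP P' hP' hs
  simp only [Sigma.mk.inj_iff, heq_eq_eq] at hs
  exact h P hP P' hP' hs.1 hs.2.1

/-- … and so is the Z-route slot `⟨rootStep, rootCell, root, record⟩` (`HistorySocketTagged.slotOfT (P.rootCell, P.toGen)`).
[folklore] -/
theorem slot_injOn_of_rootInj {S : Set (PGen γ)}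
    (h : ∀ P ∈ S, ∀ P' ∈ S, P.rootStep = P'.rootStep → P.rootCell = P'.rootCell → P = P') :
    Set.InjOn (fun P => (⟨P.toGen.rootStep, P.rootCell, P.toGen.root, P.toGen.events.erase P.toGen.root⟩ :
      T4LiveStructureGas.Slot γ PEv)) S := by
  intro P hP P' hP' hs
  simp only [PGen.rootStep_toGen, Sigma.mk.inj_iff, heq_eq_eq] at hs
  exact h P hP P' hP' hs.1 hs.2.1

/-- the tagged-pair form: on the image family `(P.rootCell, P.toGen)` the branching slot of `HistorySocketTH` (with the
identity shape map, `relabel (shape ∘ id) P.toGen = P.toGen`) is injective. [folklore] -/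
theorem relabel_shape_toGen : ∀ P : PGen γ, relabel (shape ∘ id) P.toGen = P.toGen
  | .birth j d z => by simp [PGen.toGen, shape, PEv.kind, PEv.step, PEv.fat]
  | .renew G h => by
      simp only [PGen.toGen, relabel_renew, relabel_shape_toGen G, Function.comp_apply, id]
      simp [shape, PEv.kind, PEv.step]
  | .join X Y s => by
      simp only [PGen.toGen, relabel_merge, relabel_shape_toGen X, relabel_shape_toGen Y, Function.comp_apply, id]
      simp [shape, PEv.kind, PEv.step]

/-! ## §5 Sanity, decided -/

namespace Sanity

open PGen

/-- S1's history `hist = renew (join (birth 0 1 5) (birth 2 2 9) 3) 6`: root event `(0,0,1)` [folklore] -/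
example : Sanity.hist.toGen.root = (0, 0, 1) := by rw [root_toGen]; decide

/-- … its classes are `< 3`, so every birth label of its shape tree has class `< 3`; its fuel is `≤ 4` events [folklore] -/
example : ClassLT 3 Sanity.hist ∧ (∀ e ∈ Sanity.hist.toGen.events, e.kind = 0 → e.fat < 3) ∧
    fuel Sanity.hist.toGen ≤ 4 :=
  ⟨by decide, fat_lt_of_classLT (by decide), (fuel_toGen_le _).trans (by decide)⟩

/-- … rooted at cell `5` of age `K − 0` when its constituents sit in the declared cells [folklore] -/
example : CellsIn (fun _ a => if a = 7 then {5} else {9}) 7 Sanity.hist ∧ Sanity.hist.rootCell ∈ ({5} : Finset ℕ) :=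
  ⟨by simp [Sanity.hist, CellsIn], by decide⟩

/-- within-term injectivity on a two-member family with equal root steps and distinct root cells [folklore] -/
example : Set.InjOn (fun P : PGen ℕ => (⟨P.rootStep, P.rootCell, P.toGen⟩ : BSlot ℕ PEv)) {birth 0 1 5, birth 0 1 9} :=
  bslot_injOn_of_rootInj fun P hP P' hP' _ hc => by
    simp only [Set.mem_insert_iff, Set.mem_singleton_iff] at hP hP'
    rcases hP with rfl | rfl <;> rcases hP' with rfl | rfl <;> first | rfl | (simp [PGen.rootCell] at hc)

end Sanity

end Summit.QuantumFields.BalabanUV.T4Continuum.HistorySlots
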